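import Literature.Probability.LatticeModels.DiscreteGreenKernelConvergenceProofs
import Summits.CriticalPhenomena.SAWScalingLimit.Theorems.SAWLoopFugacityFlowAvoidanceLimitGreenConvergenceFromKernelConvergence

/-!
# Stub CW33 of line `symplectic-fermion-anchor` is CLOSED: Chelkak–Wan 2021 Cor. 3.3 is now a theorem of the tree
(crux `SAWLoopFugacityFlow.AvoidanceLimit`, stmt-CriticalPhenomena-10649; lead c3)

Lead c2 reshaped the interior Green's-function convergence (GC) of the line's `n = -2` anchor into the
PRINTED Chelkak–Wan 2021 Corollary 3.3, verbatim the Literature named fact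
`Literature.Probability.LatticeModels.killedGreen_tendsto_of_kernelConvergence`, registered as the stub
`stub_killedGreenKernelConvergence` (skeleton v9), and proved `GC ⇐ CW33` by the inner/outer hole-free lattice
sandwich (`stub_greenConvergence_of_killedGreen_tendsto`, ten helper files). The named fact has since been
DISCHARGED in the tree (`killedGreen_tendsto_of_kernelConvergence_holds`,
`Literature/Probability/LatticeModels/DiscreteGreenKernelConvergenceProofs.lean`: potential-kernel
normalisation, lattice-harmonic compactness, weak Beurling boundary values, maximum-principle identification).
This file records the closure of the registered stub by name and signature, and the now UNCONDITIONAL interior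
convergence GC of the confined edge-killed Green's function — the registered stub `stub_greenConvergence` (c1 v7 / c2 v8), now
closed by name and signature. (The CW33 stub itself needs no Theorems file: the skeleton cites
`killedGreen_tendsto_of_kernelConvergence_holds` directly; a restating copy is refused by the gate's dedup.)

Sources: [ChelkakWan2021] Cor. 3.3 (§3.1); [ChelkakSmirnov2011] Thm. 3.9. No definitions, no named facts.
-/

noncomputable section

open scoped Topology
open Filter Literature.Probability.RandomPlanarGeometry Literature.Probability.LatticeModels

namespace Summit.CriticalPhenomena.SAWScalingLimit.Theorems.AvoidanceLimit.Anchor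

/-- **Registered stub `stub_greenConvergence` (GC) — closed, unconditionally.** Interior convergence of the
Green's function of the CONFINED edge-killed walk
(`confinedGraph D D' δ` on the volume `meshDomainFinset D δ`) to `c · G_ℍ(ψ⁻¹z*, ψ⁻¹y*)` for Jordan `D' ⊆ D`:
lead c2's sandwich reduction `stub_greenConvergence_of_killedGreen_tendsto` fed with the discharged
Chelkak–Wan Cor. 3.3. [cite: ChelkakWan2021, Corollary 3.3 (§3.1)] -/
theorem stub_greenConvergence :
    ∃ c : ℝ, 0 < c ∧ ∀ (D D' : JordanDomain), D'.carrier ⊆ D.carrier →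
      ∀ (ψ : ConformalEquiv UpperHalfPlane.upperHalfPlaneSet D'.carrier),
      ∀ zs ys : ℂ, zs ∈ D'.carrier → ys ∈ D'.carrier → zs ≠ ys →
      ∀ η : ℝ, 0 < η → ∃ s : ℝ, 0 < s ∧ ∀ᶠ δ in 𝓝[>] (0 : ℝ), ∀ u v : Site 2,
        dist (meshPoint δ u) zs < s → dist (meshPoint δ v) ys < s →
        |greenEntry (confinedGraph D.carrier D'.carrier δ) (meshDomainFinset D.carrier δ) u v -
          c * Real.log (‖ψ.symm zs - (starRingEnd ℂ) (ψ.symm ys)‖ / ‖ψ.symm zs - ψ.symm ys‖)| ≤ η :=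
  stub_greenConvergence_of_killedGreen_tendsto killedGreen_tendsto_of_kernelConvergence_holds

end Summit.CriticalPhenomena.SAWScalingLimit.Theorems.AvoidanceLimit.Anchor

end
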